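import Literature.NumberTheory.ComplexMultiplication.EllipticUnits.KatoEllipticZetaElement
import Mathlib.LinearAlgebra.TensorProduct.Tower
import HarnessLib

/-!
# Kato 2004 (Astérisque 295) §15.12–15.16 IN THE 15.14 FRAME (`K ⊂ ℚ(ζ_{p^∞})`): the `O_λ`-twisted
# module `H¹_{p^∞𝔣}(T) = 𝔥¹ ⊗_{ℤ_p} T(−1)` over the tree's `EllipticUnitTower`, Kato's `x_𝔞 = N𝔞 − σ_𝔞` in
# twisted coordinates, the statement SHAPES of (15.16.1)∘15.14 (weak and strong form), and the one-line
# mechanism by which the weak form is consumed — definitions, predicates and proved algebra; no named fact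

Topic `NumberTheory/EllipticCurves`, sub-directory `Kato2004` (namespace = path; grouping sub-namespace
`CMTwisted`).  Typed by seat `bsd-cm-prr-ty1` g27 (literature-prover, cell bsd-cm) on the planner's row
(GENUS-LIT-2: CM / KATO COLUMN), file (F7) of the typing map `GenusTypingMap-g57.md` REV 1.1 rows C2, C5, C6
for the frozen proof-memo `MEMO-bsd-cm-genus.md` REV 1 (a38f3eedd2c92d58) §2 (P8), §3 FRAME LEMMA, §9 (G7′)
(crux `EllipticUnitValueSevenOfGZK` = stmt-BirchSwinnertonDyer-19945, road R2, named crux K2ᶜ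
`ResidueIsGenusUnitClass`).  This file IS the `-- TODO(general form)` at the end of the module docstring
block (T7) of `ComplexMultiplication/EllipticUnits/KatoEllipticZetaElement.lean` («the `O_λ`-twisted modules
`H^i_{p^∞𝔣}(T)` and Lemma 15.13 with (15.13.1)/(15.13.2)») as far as the tree's objects allow, and the
RAMIFIED complement of `Kato2004/AdmissibleZetaClassRealisabilityCM.lean` (which keeps to §15.16's case
`K ⊄ ℚ(ζ_{p^∞})` by its hypothesis `¬ CMRamified W p`).  ONE source section — K. Kato, Astérisque 295 (2004),
**§15.12 (15.12.1)–(15.12.2) (pp. 262–263), Lemma 15.13 (p. 264), 15.14 (p. 264), 15.15 (p. 265), 15.16 with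
(15.16.1) (p. 265), Prop. 15.17 and the last line of its proof (p. 265)** [Kato2004Asterisque] (held text
`paper:doi-10-24033-ast-639`, PDF p0147–p0150; read 2026-08-30).  HONEST FRAMING: DEFINITIONS with bodies on
the existing pinned interface, statement SHAPES (`Prop`-valued predicates on an abstract skeleton, nothing
asserted — the idiom of `JohnsonLeungKings2011.ZetaSkeleton.Thm52Shape` and `EllipticUnitTower.Thm152aShape`),
and proved algebra.  NO named fact (net debt 0): the printed (15.16.1) in the frame `K ⊂ ℚ(ζ_{p^∞})` is
asserted by Kato «similarly by using 15.14» without the book-keeping, and the cell has filed exactly that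
book-keeping as the route-side CRUX K2ᶜ — a Literature fact asserting it on an abstract skeleton would be
either vacuous or a restatement of the crux (D-0026); the SHAPE is what the crux instantiates.  Nothing
about an elliptic curve, a zeta element or BSD is claimed; no summit statement is touched.

## The printed statements

* **§15.12 [pp. 262–263]** "Let `λ` be a finite place of `L`. Then we have a canonical homomorphism of
  `O_λ[[G_{p^∞𝔣}]]`-modules **(15.12.1)** `H¹_{p^∞𝔣} ⊗ T(−1) ⟶ 𝐇¹(T~)` [source: the twisted module
  `H¹_{p^∞𝔣}(T) = 𝔥¹ ⊗_{ℤ_p} T(−1)`, target: the cyclotomic Iwasawa cohomology of §12.2 of the induced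
  lattice `T~ = T ⊕ ιT`] since `𝐇¹(V_{L_λ}(f)) = 𝐇¹(V_{L_λ}(ψ)~) = lim←_n H¹(O_K ⊗ ℤ[ζ_{p^n}, 1/p], T) ⊗ ℚ`
  where `T` is any `Gal(ℚ̄/K)`-stable `O_λ`-lattice of `V_{L_λ}(ψ)`, and since we have a canonical
  homomorphism `H¹_{p^∞𝔣} ⊗ T(−1) → lim←_n H¹(O_{K ⊗ ℚ(ζ_{p^n})}[1/p], T)` [Kummer class of a unit, cup
  product with an element of `T(−1)`, corestriction from `K(p^m𝔣)` to `K(ζ_{p^n})`].  By 15.9, we have: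
  **(15.12.2)** Let `γ ∈ V_L(ψ)` and let `γ′ ∈ V_L(f)` be the image of `γ` under the isomorphism (15.11.3).
  For `n > 0`, consider the composite map `H¹_{p^∞𝔣} ⊗ V_{L_λ}(ψ)(−1) →(15.12.1) 𝐇¹(V_{L_λ}(f)) →
  H¹(ℚ_p(ζ_{p^n}), V_{L_λ}(f)(1)) →exp* S(f) ⊗_F L_λ ⊗ ℚ(ζ_{p^n})`. Let `S` be the set of
  non-zero-divisors of `ℤ_p[[G_{p^∞𝔣}]]` whose images in `ℚ_p[Gal(ℚ(ζ_{p^n})/ℚ)]` are invertible. Then the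
  induced map … sends `z_{p^∞𝔣} ⊗ γ` to an element of `S(f) ⊗_F L ⊗ ℚ(ζ_{p^n})` whose image under
  `Σ_σ χ(σ) per_f(σ(·))` … coincides with `L_S(ψ̄…, χ, k − 1)·(γ′)^±`, `± = χ(−1)`."
* **Lemma 15.13 [p. 264]** "Let `p` be a prime number and assume `K` is not contained in `ℚ(ζ_{p^∞})`.
  Let `𝔣` be the conductor of `ψ`, `Δ` the torsion part of `G_{p^∞𝔣}`, `λ` a finite place of `L` lying over
  `p`, `𝔭` a prime ideal of `O_λ[[G_∞]]`, and `𝔮` the inverse image of `𝔭` in `O_λ[[G_{p^∞𝔣}]]` under the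
  surjection `O_λ[[G_{p^∞𝔣}]] → O_λ[[G_∞]]`. Assume that `2` and the order of `Δ` are invertible in the
  residue field of `𝔭`. Then: (1) `O_λ[[G_∞]]_𝔭` and `O_λ[[G_{p^∞𝔣}]]_𝔮` are regular rings, and the kernel of
  `O_λ[[G_{p^∞𝔣}]]_𝔮 → O_λ[[G_∞]]_𝔭` is a principal ideal. (2) Let `a` be a generator of the principal ideal in
  (1). Let `T` be a `Gal(ℚ̄/K)`-stable `O_λ`-lattice of `V_{L_λ}(ψ)` and let `T~ = T ⊕ ιT ⊂ V_{L_λ}(ψ)~`. Then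
  we have **(15.13.1)** `H²_{p^∞𝔣}(T)_𝔮/aH²_{p^∞𝔣}(T)_𝔮 ≅ 𝐇²(T~)_𝔭` and an exact sequence **(15.13.2)**
  `0 → H¹_{p^∞𝔣}(T)_𝔮/aH¹_{p^∞𝔣}(T)_𝔮 → 𝐇¹(T~)_𝔭 → Ker(a; H²_{p^∞𝔣}(T)_𝔮) → 0`.  Proof. — Consider the exact
  sequence of representations of `Gal(ℚ̄/K)` `0 → T ⊗_{O_λ} O_λ[[G_{p^∞𝔣}]] →(a) T ⊗_{O_λ} O_λ[[G_{p^∞𝔣}]] →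
  T ⊗_{O_λ} O_λ[[G_∞]] → 0` where `σ ∈ Gal(ℚ̄/K)` acts on `O_λ[[G_{p^∞𝔣}]]` (resp. `O_λ[[G_∞]]`) by the
  multiplication by the image of `σ⁻¹` … [the cokernels at `v ∤ p` are killed by the order of `Δ`]."
* **15.14 [p. 264]** "In the case `K ⊂ ℚ(ζ_{p^∞})`, Lemma 15.13 is modified as follows. Let
  `G′_∞ = Gal(ℚ(ζ_{p^∞})/K) ⊂ G_∞`, and let `H^q(T) = lim←_n H^q(ℤ[ζ_{p^n}, 1/p], T)`. Then
  `𝐇^q(T~) = H^q(T) ⊗_{O_λ[[G′_∞]]} O_λ[[G_∞]]`. Lemma 15.13 holds when we replace `G_∞` by `G′_∞`, and `𝐇^q(T~)`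
  by `H^q(T)`."
* **15.15 [p. 265]** "We prove Thm. 12.4 for `f`. … We first assume `K` is not contained in `ℚ(ζ_{p^∞})`. …
  By 13.5 and (15.12.2), the image of `z_{p^∞𝔣} ⊗ V_{L_λ}(ψ)(−1)` under `H¹_{p^∞𝔣}(V_{L_λ}(ψ))_𝔮 → 𝐇¹(V_{L_λ}(f))_𝔭`
  is not zero. … Hence by the theorem 15.2 by Rubin … The proof for the case `K ⊂ ℚ(ζ_{p^∞})` goes similarly
  by using 15.14 instead of 15.13."
* **15.16 [p. 265]** "We prove Thm. 12.5 and Thm. 12.6 for `f` in the case `K` is not contained in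
  `ℚ(ζ_{p^∞})`. … Next we prove Thm. 12.5 (3) (Thm. 12.5 (4) does not exist in the case with complex
  multiplication). By (15.12.2) and Thm. 12.4 (2), we have: **(15.16.1)** Let `γ ∈ V_L(ψ)` and let `γ′` be
  the image of `γ` in `V_L(f)` under (15.11.3). Then the homomorphism (15.12.1) sends
  `z_{p^∞𝔣} ⊗ γ ⊗ (ζ_{p^n})_n^{⊗(−1)}` to `z^{(p)}_{γ′}`.  Hence 12.5 (3) is reduced to Proposition 15.17."
  **Prop. 15.17, proof, last line [p. 265]** "The proof for the case `K ⊂ ℚ(ζ_{p^∞})` goes similarly by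
  using 15.14 instead of 15.13."  — (15.16.1) is thus PRINTED for `K ⊄ ℚ(ζ_{p^∞})` and ASSERTED «similarly»
  for `K ⊂ ℚ(ζ_{p^∞})`; writing out (15.12.1)∘15.14 with its constant for `K = ℚ(√−p) ⊂ ℚ(ζ_p)` is the
  route's named crux K2ᶜ (typing map row C6; memo §9).

## The tree–Kato dictionary for the frame `K ⊂ ℚ(ζ_{p^∞})` (memo §3 FRAME LEMMA; CONVENTIONS ARE CONTENT)

* **Branches.** `G_∞ = Δ × Γ`, `Δ ≅ (ℤ/p)^×` of order prime to `p`; the tree's `Kato2004.IwasawaH1Data W p κ γ`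
  is the `Δ`-TRIVIAL component `e₀·𝐇¹(T_pW)` of Kato's `𝐇¹` along the cyclotomic `ℤ_p`-extension `κ`
  (READING of `Kato2004/IwasawaCohomology.lean`).  The tree's lattice is `T_pW = H¹_ét(W̄, ℤ_p)(1)`, Kato's is
  `V_{O_λ}(f) ⊂ H¹_ét(W̄, ℚ_p)` (cohomological, `det = κ_cyc⁻¹`): the Tate twist `tw_ζ : x ↦ x ∪ (ζ_{p^n})_n` is a
  `g`-semilinear isomorphism `𝐇¹(L) ≅ 𝐇¹(L(1))` with `tw(e_β·𝐇¹(L)) = e_{βω}·𝐇¹(L(1))` (`ω = κ_cyc|_Δ`), so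
  **tree-branch 0 = Kato-branch `ω⁻¹`** (memo (F1)); and the `(ζ_{p^n})^{⊗(−1)}_n` of (15.16.1) CANCELS against
  the tree's `(1)`: on tree-branch 0 the twisting element of (15.12.1) is the generator `e` of
  `T_ψ(1)(−1) = T_ψ` itself (memo (F3)).  Consequently NO cyclotomic-twist map is needed in the tree's
  currency and none is defined here.
  -- TODO(general form): `cyclotomicTwistIw : 𝐇¹_Iw(F_∞, T) ≃ 𝐇¹_Iw(F_∞, T(1))` for `F_∞ ⊇ μ_{p^∞}` with the
  -- Δ-shift `e_β ↦ e_{βω}`, for consumers working in Kato's cohomological frame (typing map row C2).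
* **15.14 = Shapiro for the index-2 subgroup `G′_∞ ⊂ G_∞`, in tree currency.**  For `W/ℚ` with CM by `O_K`
  and `p` RAMIFIED in `K` (`K = ℚ(√−p) ⊂ ℚ(ζ_p)`, `p` odd), `K ∩ ℚ_∞ = ℚ`, so the cyclotomic
  `ℤ_p`-extension `κ` of `ℚ` RESTRICTS to the cyclotomic `ℤ_p`-extension of `K` (tree theorem
  `surjective_comp_absGaloisRestrict_of_not_dvd_finrank κ K (p ∤ 2)`, file `ZpExtensionRestrictProofs.lean`,
  giving `κ.restrict K h`), and Kato's `𝐇¹(T~) = 𝐇¹(T) ⊗_{O_λ[[G′_∞]]} O_λ[[G_∞]]` read on branch 0 for the stable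
  lattice `T = T_pW|_{Gal(ℚ̄/K)}` (an `O_𝔭 = O_K ⊗ ℤ_p`-module of rank one through the CM endomorphisms,
  `Gal(ℚ̄/K)` acting `O_𝔭`-linearly — tree theorem `WeierstrassCurve.commute_rationalGaloisRepTate_of_hasRationalCM`)
  is the pair of PINNED carriers `I : Kato2004.IwasawaH1Data W p κ γ` (the `ℚ`-tower) and
  `IK : Kato2004.IwasawaH1DataOver (W.baseChange K) p (κ.restrict K h) γK` (the `K`-tower,
  `IwasawaCohomologyNumberField.lean`, existence `nonempty_iwasawaH1DataOver`) with the Shapiro maps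
  `I.resOver … : I.H →ₗ[Λ] IK.H`, `IK.corOver … : IK.H →ₗ[Λ] I.H` (`IwasawaCohomologyNumberFieldRestriction/
  Corestriction/ResCor.lean`: `cor ∘ res = 2 = [K : ℚ]`, `res ∘ cor = 1 + c`) — the memo's
  `𝐇′(S′) ≅ H¹_Iw(Kℚ_∞/K, T_ψ(1))` (§9) and `𝐇′(T_W^O) = I.H ⊗ O_𝔭 ↪ 𝐇′(S′)` (§4 (L4)).  Nothing new is
  needed for 15.14 itself; the `O_𝔭`-structure on `IK.H` (CM endomorphisms acting on the levels) and the
  split lattice `S′` are the route-side port's (F8) constructions, with the algebra of the sibling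
  `CMInducedRepresentation.lean` (F6).
* **(15.12.1) source = §1 below.**  The twisted module `H¹_{p^∞𝔣}(T) = 𝔥¹ ⊗_{ℤ_p} T(−1)` is typed ON THE EXISTING
  interface `D : Kato2004.EllipticUnitTower K p 𝔣 ι` (`KatoEllipticZetaElement.lean`: `D.H = 𝔥¹`,
  `D.ell 𝔞 = (_𝔞z_{p^n𝔣})_n`, `D.artin 𝔞 = σ_𝔞`, `D.nsub 𝔞 = N𝔞 − σ_𝔞`, pins (E1)/(E2)) with coefficients in any
  `ℤ_p`-algebra `O` (meant: `O_λ`, with `T(−1) ≅ O_λ` as a module, `G_{p^∞𝔣}` acting on `T(−1)` through a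
  character `χ` — Kato §15.8: the Artin symbol of `𝔞` acts on `V_{L_λ}(ψ)` as `ψ(𝔞)⁻¹`, and on the Tate twist
  `ℤ_p(−1)` as `N(𝔞)⁻¹`).  Since `D.Λ` is an ABSTRACT ring (honest limit (T3) of that file: only the action is
  pinned), the twist automorphism `σ ↦ χ(σ)σ` of `O_λ[[G_{p^∞𝔣}]]` is not available as a ring map; what is
  typed is the base change `Λ_O ⊗_Λ 𝔥¹` along an abstract commutative `Λ`-algebra `ΛO` (meant: `O_λ[[G_{p^∞𝔣}]]`
  with the UNTWISTED inclusion of `Λ`), the DIAGONAL Artin elements `σ̃_𝔞 = χ(𝔞)·σ_𝔞 ∈ Λ_O` (`artinTwist χ 𝔞`), which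
  by pin (Λ3) (density) determine the twist, and the identity — Kato's element «`x_𝔞` = image of `N𝔞 − σ_𝔞`» in
  TWISTED coordinates — `x_𝔞 = N𝔞 − χ(𝔞)⁻¹·σ̃_𝔞` (`xTwist_eq`), together with the twisted form of (15.4.4)
  (`xTwist_smul_ellTwist_comm`, PROVED from pin (E2)) and (15.6.3) (`xTwist_smul_mem_span_ellTwist`); this is exactly the normalisation
  recorded for the finite-order twist in `ImaginaryQuadraticMainConjectureCarriers.lean` (T3) («`nsubElt 𝔞 =
  N𝔞 − χ(σ_𝔞)⁻¹·(group element)`»).  ONLY `ell`, `artin`, `nsub`, (E2) are consumed; nothing new on the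
  `𝔥¹` side.
* **(15.16.1)∘15.14 as a SHAPE (§2).**  On an abstract `Λ_O`-module `A` (meant: `𝐇′(𝒱′) = 𝐇′(S′) ⊗ K_𝔭`) with a
  submodule `HS` (`𝐇′(S′)`), a vector `zγ` (`𝐳_{γ′}`, `γ′ = (15.11.3)(e_B, 0)`) and classes `EU 𝔞 ∈ HS` (the
  (15.12.1)∘15.14-images of `(_𝔞z_{p^m𝔣})_m ⊗ e_B`), the WEAK form «`EU 𝔞 ∈ Λ_O·𝐳_{γ′}`» (memo §9 (W-K2ᶜ),
  card REV 8) is `Kato15161WeakShape`, the STRONG form «`EU 𝔞 = c₁·x_𝔞·𝐳_{γ′}`, `v_π(c₁) = 0`» (Kato's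
  (15.16.1) = `z_{γ′} = (N𝔞 − σ_𝔞)⁻¹·EU_𝔞` with the constant made explicit) is `Kato15161StrongShape`; strong ⇒
  weak (`Kato15161StrongShape.weak`).  The memo's step (G7′)(2)–(3) — «`red` kills `π·𝐇′(S′)`; if
  `𝐳_{γ_{S′}⁺} ∈ π·𝐇′(S′)` then `EU_𝔞 ∈ π·𝐇′(S′)` and `red(EU_𝔞) = 0`» — is PROVED once on the skeleton
  (`not_exists_eq_smul_of_weakShape`): weak form + ONE non-zero residue ⇒ (K2_S) = the hypothesis `hS` of
  the kernel lemma `k2_transfer_of_split` (`Cruxes/EllipticUnitValueSevenOfGZK/KatoGenusResidueSketch.lean`).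

## What is NOT here (scope)

The (15.12.1) MAP itself (Kummer class ∪ `e`, corestriction to `K_n`; typing map rows C6/C8 — route side),
(15.12.2) (the VALUE identity; its elliptic-curve instance is the tree's Prop. 15.9 file
`EllipticZetaReciprocity.lean` on the `K`-side and `Kato2004.ZetaBody` on the `ℚ`-side), Lemma 15.13 /
(15.13.1) / (15.13.2) (localisation book-keeping; the `K`-side set-up is block (T7) of
`KatoEllipticZetaElement.lean`), `H²_{p^∞𝔣}`, Prop. 15.17, the cyclotomic twist map, any `instance`, notation,
`sorry`, or named fact.
-- TODO(general form): the twist automorphism `σ ↦ χ(σ)σ` of `O_λ[[G_{p^∞𝔣}]]` on a CONSTRUCTED completed group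
-- ring and `H^i_{p^∞𝔣}(T)` as `O_λ[[G_{p^∞𝔣}]]`-modules; Lemma 15.13 (1)(2) and 15.14 as theorems; (15.16.1)
-- for `K ⊄ ℚ(ζ_{p^∞})` as a named fact on pinned carriers once (15.12.1) is a typed map.

## References

* K. Kato, Astérisque 295 (2004): §15.8 (p. 256–257: the action of `(𝔞, K(p^∞𝔣)/K)` by `ψ(𝔞)⁻¹`), §15.12
  (15.12.1)–(15.12.2) (pp. 262–263), Lemma 15.13 (p. 264), 15.14 (p. 264), 15.15–15.16 (15.16.1), Prop. 15.17
  (p. 265). [Kato2004Asterisque]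
* J. Johnson-Leung, G. Kings, J. reine angew. Math. 653 (2011), §3.3 (5), §5.2 (the twisted classes
  `_𝔞ζ(χ) = _𝔞ζ ⊗ t(χ)` and `(N𝔞 − σ_𝔞)` in twisted coordinates) — through the tree's
  `ImaginaryQuadraticMainConjectureCarriers.lean` (T3). [JohnsonLeungKings2011]
* Frozen memo `pub/bsd-cm/frozen/MEMO-bsd-cm-genus.v1.a38f3eedd2c92d58.md` §2 (P8), §3 (F1)–(F5), §4 (L4), §9;
  typing map `Cruxes/EllipticUnitValueSevenOfGZK/GenusTypingMap-g57.md` REV 1.1 rows C2, C5, C6; kernel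
  `KatoGenusResidueSketch.lean`.
* Tree: `ComplexMultiplication/EllipticUnits/KatoEllipticZetaElement.lean` (`EllipticUnitTower`, block (T7) and
  its TODO), `Kato2004/IwasawaCohomology{,NumberField,NumberFieldRestriction,NumberFieldCorestriction,
  NumberFieldResCor,Coeff}.lean`, `ZpExtensionRestrictProofs.lean`, `Kato2004/CMInducedRepresentation.lean` (F6).
-/

noncomputable section

open scoped TensorProduct NumberField
open Literature.NumberTheory.ComplexMultiplication.EllipticUnits
open Literature.NumberTheory.ComplexMultiplication.EllipticUnits.Kato2004

namespace Literature.NumberTheory.EllipticCurves.Kato2004.CMTwisted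

/-! ## §1 (15.12.1), source: the twisted module `H¹_{p^∞𝔣}(T) = 𝔥¹ ⊗_{ℤ_p} T(−1)` on the `EllipticUnitTower` -/

section Twisted

variable {K : Type} [Field K] [NumberField K] {p : ℕ} [Fact p.Prime] {𝔣 : Ideal (𝓞 K)} {ι : K →+* ℂ}
  (D : EllipticUnitTower K p 𝔣 ι) (ΛO : Type) [CommRing ΛO] [Algebra D.Λ ΛO]

/-- **Kato's twisted module `H¹_{p^∞𝔣}(T) = 𝔥¹ ⊗_{ℤ_p} T(−1)`** for a twisting module `T(−1)` free of rank one over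
`O_λ`: as a module over `Λ_O = O_λ[[G_{p^∞𝔣}]] = Λ ⊗_{ℤ_p} O_λ` (an abstract commutative `Λ`-algebra `ΛO` here,
`Λ = D.Λ` the ring of the pinned interface; `𝔥¹ ⊗_{ℤ_p} O_λ = 𝔥¹ ⊗_Λ Λ_O`) it is the base change `Λ_O ⊗_Λ 𝔥¹`
with the UNTWISTED inclusion `Λ ⊂ Λ_O`; the `G_{p^∞𝔣}`-action Kato uses is the DIAGONAL one, carried by the
elements `artinTwist` below.  [cite: Kato2004Asterisque, §15.12 (15.12.1) (p. 262) and proof of Lemma 15.13 (p. 264, "T ⊗_{O_λ} O_λ[[G_{p^∞𝔣}]]")] -/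
abbrev TwistedH1 : Type := ΛO ⊗[D.Λ] D.H

/-- The class `1 ⊗ z ∈ H¹_{p^∞𝔣}(T)` of `z ∈ 𝔥¹` (`z ⊗ t` with `t` the chosen generator of `T(−1)`).
[cite: Kato2004Asterisque, §15.12 (p. 263, "z_{p^∞𝔣} ⊗ γ")] -/
def toTwisted (z : D.H) : TwistedH1 D ΛO :=
  (1 : ΛO) ⊗ₜ[D.Λ] z

/-- **The twisted elliptic-unit class `(_𝔞z_{p^n𝔣})_n ⊗ t ∈ H¹_{p^∞𝔣}(T)`** — the element fed into (15.12.1)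
(for `t = γ ⊗ ζ^{⊗(−1)}`: the left-hand side of (15.16.1) before `(N𝔞 − σ_𝔞)⁻¹`).
[cite: Kato2004Asterisque, §15.16 (15.16.1) (p. 265) with §15.6 (p. 254, "z_{p^∞𝔣} = (N(𝔞) − (𝔞, K(p^∞𝔣)/K))⁻¹ (_𝔞z_{pⁿ𝔣})_n")] -/
def ellTwist (𝔞 : Ideal (𝓞 K)) : TwistedH1 D ΛO :=
  toTwisted D ΛO (D.ell 𝔞)

/-- `toTwisted` is additive. [cite: Kato2004Asterisque, §15.12 (15.12.1) (p. 262)] -/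
theorem toTwisted_add (z z' : D.H) : toTwisted D ΛO (z + z') = toTwisted D ΛO z + toTwisted D ΛO z' :=
  TensorProduct.tmul_add _ _ _

/-- **The UNTWISTED action of `f ∈ Λ` on `H¹_{p^∞𝔣}(T) = Λ_O ⊗_Λ 𝔥¹` is through `𝔥¹`**: `f·(1 ⊗ z) = 1 ⊗ (f·z)`.
[cite: Kato2004Asterisque, §15.12 (15.12.1) (p. 262)] -/
theorem algebraMap_smul_toTwisted (f : D.Λ) (z : D.H) :
    algebraMap D.Λ ΛO f • toTwisted D ΛO z = toTwisted D ΛO (f • z) := by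
  rw [toTwisted, toTwisted, TensorProduct.smul_tmul', smul_eq_mul, mul_one, Algebra.algebraMap_eq_smul_one,
    TensorProduct.smul_tmul]

/-- **Kato's DIAGONAL Artin element `σ̃_𝔞 ∈ Λ_O`**: on `H¹_{p^∞𝔣}(T) = 𝔥¹ ⊗ T(−1)` the group element
`σ_𝔞 = (𝔞, K(p^∞𝔣)/K)` acts by `σ̃_𝔞(z ⊗ t) = σ_𝔞z ⊗ σ_𝔞t = χ(𝔞)·(σ_𝔞z ⊗ t)`, where `χ(𝔞) ∈ Λ_O^×` is the scalar by which
`σ_𝔞` acts on the rank-one twisting module `T(−1)` (§15.8: `ψ(𝔞)⁻¹` on `V_{L_λ}(ψ)`, times `N(𝔞)⁻¹` on `ℤ_p(−1)`); so the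
element of `Λ_O` acting as Kato's `σ_𝔞` does is `χ(𝔞)·σ_𝔞` — the twist automorphism «`σ ↦ χ(σ)σ`» of
`O_λ[[G_{p^∞𝔣}]]` evaluated on the generators (by pin (Λ3), density, these determine it).
[cite: Kato2004Asterisque, §15.8 (p. 257, "(𝔞, K(p^∞𝔣)/K) acts on V_{L_λ}(ψ) as the multiplication by ψ(𝔞)⁻¹") and proof of Lemma 15.13 (p. 264, "σ acts … by the multiplication by the image of σ⁻¹")] -/
def artinTwist (χ : Ideal (𝓞 K) → ΛOˣ) (𝔞 : Ideal (𝓞 K)) : ΛO :=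
  (χ 𝔞 : ΛO) * algebraMap D.Λ ΛO (D.artin 𝔞)

/-- `σ̃_𝔞·(1 ⊗ z) = χ(𝔞)·(1 ⊗ σ_𝔞z)`. [cite: Kato2004Asterisque, §15.12 (15.12.1) (p. 262)] -/
theorem artinTwist_smul_toTwisted (χ : Ideal (𝓞 K) → ΛOˣ) (𝔞 : Ideal (𝓞 K)) (z : D.H) :
    artinTwist D ΛO χ 𝔞 • toTwisted D ΛO z = (χ 𝔞 : ΛO) • toTwisted D ΛO (D.artin 𝔞 • z) := by
  rw [artinTwist, mul_smul, algebraMap_smul_toTwisted]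

/-- **Kato's `x_𝔞 ∈ Λ_O`**: the (untwisted) image of `N𝔞 − σ_𝔞 ∈ ℤ_p[[G_{p^∞𝔣}]]` — the element inverted in
`z_{p^∞𝔣} = (N𝔞 − σ_𝔞)⁻¹(_𝔞z_{pⁿ𝔣})_n` (§15.6) and hence in the left-hand side of (15.16.1).
[cite: Kato2004Asterisque, §15.6 (p. 254) and §15.16 (15.16.1) (p. 265)] -/
def xTwist (𝔞 : Ideal (𝓞 K)) : ΛO :=
  algebraMap D.Λ ΛO (D.nsub 𝔞)

/-- **`x_𝔞` in TWISTED coordinates: `x_𝔞 = N𝔞 − χ(𝔞)⁻¹·σ̃_𝔞`** — the same normalisation as the finite-order case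
`nsubElt 𝔞 = N𝔞 − χ(σ_𝔞)⁻¹·(group element)` of the tree's JLK carriers.
[cite: Kato2004Asterisque, §15.16 (15.16.1) (p. 265) with §15.6 (p. 254)] [cite: JohnsonLeungKings2011, §5.2 ("ζ(χ) := (N𝔞 − σ_𝔞)⁻¹ _𝔞ζ(χ)")] -/
theorem xTwist_eq (χ : Ideal (𝓞 K) → ΛOˣ) (𝔞 : Ideal (𝓞 K)) :
    xTwist D ΛO 𝔞 = (Ideal.absNorm 𝔞 : ΛO) - (↑(χ 𝔞)⁻¹ : ΛO) * artinTwist D ΛO χ 𝔞 := by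
  rw [xTwist, EllipticUnitTower.nsub_def, map_sub, map_natCast, artinTwist, ← mul_assoc, Units.inv_mul, one_mul]

/-- `x_𝔞·(1 ⊗ z) = 1 ⊗ ((N𝔞 − σ_𝔞)·z)`. [cite: Kato2004Asterisque, §15.6 (p. 254)] -/
theorem xTwist_smul_toTwisted (𝔞 : Ideal (𝓞 K)) (z : D.H) :
    xTwist D ΛO 𝔞 • toTwisted D ΛO z = toTwisted D ΛO (D.nsub 𝔞 • z) :=
  algebraMap_smul_toTwisted D ΛO _ z

/-- **(15.4.4) / pin (E2) in the twisted module**: `x_𝔟·((_𝔞z) ⊗ t) = x_𝔞·((_𝔟z) ⊗ t)` for admissible twists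
`𝔞, 𝔟` — so the `𝔞`-free class `z_{p^∞𝔣} ⊗ t = x_𝔞⁻¹·((_𝔞z) ⊗ t)` of (15.16.1) does not depend on `𝔞` wherever the
`x_𝔞` are invertible. PROVED from `D.ell_indep`.
[cite: Kato2004Asterisque, §15.6 (p. 254, "z_{p^∞𝔣} is independent of the choice of 𝔞 … by (15.4.4)") and §15.16 (15.16.1) (p. 265)] -/
theorem xTwist_smul_ellTwist_comm {𝔞 𝔟 : Ideal (𝓞 K)} (h𝔞 : IsTwist p 𝔣 𝔞) (h𝔟 : IsTwist p 𝔣 𝔟) :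
    xTwist D ΛO 𝔟 • ellTwist D ΛO 𝔞 = xTwist D ΛO 𝔞 • ellTwist D ΛO 𝔟 := by
  rw [ellTwist, ellTwist, xTwist_smul_toTwisted, xTwist_smul_toTwisted, EllipticUnitTower.nsub_def,
    EllipticUnitTower.nsub_def, D.ell_indep 𝔞 𝔟 h𝔞 h𝔟]

/-- The same relation written with the diagonal elements: `(N𝔟 − χ(𝔟)⁻¹σ̃_𝔟)·((_𝔞z) ⊗ t) = (N𝔞 − χ(𝔞)⁻¹σ̃_𝔞)·((_𝔟z) ⊗ t)`.
[cite: Kato2004Asterisque, §15.16 (15.16.1) (p. 265) with §15.6 (p. 254)] [cite: JohnsonLeungKings2011, Prop. 3.3 (3) and §5.2] -/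
theorem twisted_indep (χ : Ideal (𝓞 K) → ΛOˣ) {𝔞 𝔟 : Ideal (𝓞 K)} (h𝔞 : IsTwist p 𝔣 𝔞)
    (h𝔟 : IsTwist p 𝔣 𝔟) :
    ((Ideal.absNorm 𝔟 : ΛO) - (↑(χ 𝔟)⁻¹ : ΛO) * artinTwist D ΛO χ 𝔟) • ellTwist D ΛO 𝔞 =
      ((Ideal.absNorm 𝔞 : ΛO) - (↑(χ 𝔞)⁻¹ : ΛO) * artinTwist D ΛO χ 𝔞) • ellTwist D ΛO 𝔟 := by
  rw [← xTwist_eq, ← xTwist_eq, xTwist_smul_ellTwist_comm D ΛO h𝔞 h𝔟]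

/-- **The twisted part of elliptic units `ℨ ⊗ t = Λ_O·(ℨ ⊗ 1) ⊆ H¹_{p^∞𝔣}(T)`**: the base change of `ℨ = D.Z` (Mathlib
`Submodule.baseChange`; at a height-one `𝔮` with some `x_𝔞 ∉ 𝔮` it is `Λ_{O,𝔮}·(z_{p^∞𝔣} ⊗ t)`, (15.6.4)).
[cite: Kato2004Asterisque, §15.6 (15.6.4) (p. 254) and Prop. 15.17 (p. 265, "the … submodule … generated by the image of z_{p^∞𝔣} ⊗ T(−1)")] -/
def twistedZ : Submodule ΛO (TwistedH1 D ΛO) :=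
  (D.Z).baseChange ΛO

/-- `(_𝔞z) ⊗ t ∈ ℨ ⊗ t` for an admissible twist `𝔞`. [cite: Kato2004Asterisque, §15.6 (p. 254)] -/
theorem ellTwist_mem_twistedZ {𝔞 : Ideal (𝓞 K)} (h𝔞 : IsTwist p 𝔣 𝔞) :
    ellTwist D ΛO 𝔞 ∈ twistedZ D ΛO :=
  Submodule.tmul_mem_baseChange_of_mem 1 (D.ell_mem_Z h𝔞)

/-- `x_𝔞·(ℨ ⊗ t) ⊆ Λ_O·((_𝔞z) ⊗ t)` — (15.6.3) in the twisted module (from `D.nsub_smul_mem_cyclic_of_mem_Z`).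
[cite: Kato2004Asterisque, §15.6 (15.6.3) (p. 254)] -/
theorem xTwist_smul_mem_span_ellTwist {𝔞 : Ideal (𝓞 K)} (h𝔞 : IsTwist p 𝔣 𝔞) {x : TwistedH1 D ΛO}
    (hx : x ∈ twistedZ D ΛO) : xTwist D ΛO 𝔞 • x ∈ ΛO ∙ ellTwist D ΛO 𝔞 := by
  rw [twistedZ, Submodule.baseChange_eq_span] at hx
  induction hx using Submodule.span_induction with
  | mem y hy =>
    obtain ⟨z, hz, rfl⟩ := hy
    have hz' : D.nsub 𝔞 • z ∈ D.cyclic 𝔞 := D.nsub_smul_mem_cyclic_of_mem_Z h𝔞 hz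
    obtain ⟨r, hr⟩ := Submodule.mem_span_singleton.mp hz'
    change xTwist D ΛO 𝔞 • toTwisted D ΛO z ∈ _
    rw [xTwist_smul_toTwisted, ← hr, ← algebraMap_smul_toTwisted]
    exact Submodule.smul_mem _ _ (Submodule.mem_span_singleton_self _)
  | zero => simp
  | add y z _ _ hy hz => rw [smul_add]; exact Submodule.add_mem _ hy hz
  | smul a y _ hy => rw [smul_comm]; exact Submodule.smul_mem _ a hy

end Twisted

/-! ## §2 (15.16.1)∘15.14 as a statement SHAPE on an abstract skeleton, and the mechanism of its use -/

section Shape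

variable {K : Type} [Field K]

/-- **The skeleton on which (15.16.1)∘15.14 is stated** (abstract carriers; NOTHING asserted, existence not
asserted — the idiom of `JohnsonLeungKings2011.ZetaSkeleton`).  Meant (memo §9, frame `K = ℚ(√−p) ⊂ ℚ(ζ_p)`):
`R = Λ_O = O_𝔭⟦Γ⟧`; `A = 𝐇′(𝒱′)`, the `K_𝔭`-span of the branch-0 Iwasawa cohomology of the induced lattice;
`HS = 𝐇′(S′) ≅ H¹_Iw(Kℚ_∞/K, T_ψ(1))` (15.14) for Kato's split lattice `S′ = (15.11.2)(T_ψ ⊕ ιT_ψ)`;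
`zeta = 𝐳_{γ′}`, Kato's zeta element for the Betti class `γ′ = (15.11.3)(e_B, 0)`; `x 𝔞 ∈ R` = the image of
`N𝔞 − σ_𝔞` (§1, `xTwist`, `xTwist_eq`); `EU 𝔞 ∈ A` = the image under (15.12.1)∘15.14 of
the twisted elliptic-unit class `(_𝔞z_{p^m𝔣})_m ⊗ e_B ⊗ ζ^{⊗(−1)}` (an INTEGRAL class: Kummer classes of units, cup
product, corestriction).  [cite: Kato2004Asterisque, §15.12 (15.12.1) (p. 262), 15.14 (p. 264), §15.16 (15.16.1) (p. 265)] -/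
structure Frame1516 (R : Type) [CommRing R] (A : Type) [AddCommGroup A] [Module R A] : Type where
  /-- `𝐇′(S′) ⊆ 𝐇′(𝒱′)`: the integral classes of the split lattice. -/
  HS : Submodule R A
  /-- Kato's zeta element `𝐳_{γ′}` of the Betti class `γ′ = (15.11.3)(e_B, 0)`. -/
  zeta : A
  /-- `x_𝔞`: the twisted image of `N𝔞 − σ_𝔞` in `R = Λ_O`. -/
  x : Ideal (𝓞 K) → R
  /-- `EU_𝔞`: the (15.12.1)∘15.14-image of `(_𝔞z_{p^m𝔣})_m ⊗ e_B ⊗ ζ^{⊗(−1)}`. -/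
  EU : Ideal (𝓞 K) → A
  /-- The elliptic-unit classes are integral: `EU_𝔞 ∈ 𝐇′(S′)`. -/
  EU_mem : ∀ 𝔞, EU 𝔞 ∈ HS

variable {R : Type} [CommRing R] {A : Type} [AddCommGroup A] [Module R A] (p : ℕ) (𝔣 : Ideal (𝓞 K))

/-- **(15.16.1)∘15.14, STRONG form, as a predicate** (Kato's printed identity `z^{(p)}_{γ′} = ` image of
`z_{p^∞𝔣} ⊗ γ ⊗ ζ^{⊗(−1)}`, i.e. `x_𝔞·𝐳_{γ′} = EU_𝔞` up to ONE constant `c₁ ∈ R^×` common to all admissible `𝔞`;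
the crux K2ᶜ claims `v_π(c₁) = 0`, here `c₁` is a unit of `R`).  A predicate; nothing asserted.
[cite: Kato2004Asterisque, §15.16 (15.16.1) (p. 265) and Prop. 15.17, proof, last line (p. 265, "similarly by using 15.14")] -/
def Kato15161StrongShape (F : Frame1516 (K := K) R A) : Prop :=
  ∃ c₁ : Rˣ, ∀ 𝔞 : Ideal (𝓞 K), IsTwist p 𝔣 𝔞 → F.EU 𝔞 = ((c₁ : R) * F.x 𝔞) • F.zeta

/-- **(15.16.1)∘15.14, WEAK form, as a predicate** (memo §9 (W-K2ᶜ), card REV 8: «`EU_𝔞 ∈ Λ_O·𝐳_{γ′}`» — the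
comparison constant is INTEGRAL; no unit claim, the shape of `x_𝔞` irrelevant).  A predicate; nothing asserted.
[cite: Kato2004Asterisque, §15.16 (15.16.1) (p. 265)] -/
def Kato15161WeakShape (F : Frame1516 (K := K) R A) : Prop :=
  ∀ 𝔞 : Ideal (𝓞 K), IsTwist p 𝔣 𝔞 → ∃ C : R, F.EU 𝔞 = C • F.zeta

/-- Strong ⇒ weak (`C = c₁·x_𝔞`). [cite: Kato2004Asterisque, §15.16 (15.16.1) (p. 265)] -/
theorem Kato15161StrongShape.weak {F : Frame1516 (K := K) R A} (h : Kato15161StrongShape p 𝔣 F) :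
    Kato15161WeakShape p 𝔣 F := by
  obtain ⟨c₁, hc⟩ := h
  exact fun 𝔞 h𝔞 ↦ ⟨(c₁ : R) * F.x 𝔞, hc 𝔞 h𝔞⟩

/-- **The mechanism of memo §9 (G7′)(2)–(3), PROVED on the skeleton**: if the weak form holds, if `𝐳_{γ′} = t·zS`
for some `t ∈ R` (the `½` of memo §5: `𝐳_{γ′} = ½·𝐳_{γ_{S′}⁺}`), and if some map `red` (reduction mod `π`)
vanishing on `π·𝐇′(S′)` does NOT vanish on one elliptic-unit class `EU_𝔞` (memo (G7′)(1): the residue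
`12·R_n ⊗ ē₋ ≠ 0`), then `zS ∉ π·𝐇′(S′)` — statement (K2_S), the hypothesis `hS` of the kernel lemma
`k2_transfer_of_split`.  («If `𝐳_{γ_{S′}⁺} ∈ π·𝐇′(S′)`, then `EU_𝔞 ∈ ½C_𝔞·π·𝐇′(S′) ⊂ π·𝐇′(S′)`, so `red(EU_𝔞) = 0`.»)
[cite: Kato2004Asterisque, §15.16 (15.16.1) (p. 265) with Thm. 12.4 (2) (p. 221, torsion-freeness of 𝐇¹)] -/
theorem not_exists_eq_smul_of_weakShape {F : Frame1516 (K := K) R A} (h : Kato15161WeakShape p 𝔣 F)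
    {π t : R} {zS : A} (hz : F.zeta = t • zS)
    {B : Type} [AddCommGroup B] [Module R B] (red : A →ₗ[R] B) (hred : ∀ y ∈ F.HS, red (π • y) = 0)
    {𝔞 : Ideal (𝓞 K)} (h𝔞 : IsTwist p 𝔣 𝔞) (hne : red (F.EU 𝔞) ≠ 0) :
    ∀ y ∈ F.HS, zS ≠ π • y := by
  intro y hy hzS
  obtain ⟨C, hC⟩ := h 𝔞 h𝔞
  apply hne
  rw [hC, hz, hzS, smul_smul, smul_comm]
  exact hred _ (F.HS.smul_mem (C * t) hy)

/-- The same with the strong form. [cite: Kato2004Asterisque, §15.16 (15.16.1) (p. 265)] -/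
theorem not_exists_eq_smul_of_strongShape {F : Frame1516 (K := K) R A} (h : Kato15161StrongShape p 𝔣 F)
    {π t : R} {zS : A} (hz : F.zeta = t • zS)
    {B : Type} [AddCommGroup B] [Module R B] (red : A →ₗ[R] B) (hred : ∀ y ∈ F.HS, red (π • y) = 0)
    {𝔞 : Ideal (𝓞 K)} (h𝔞 : IsTwist p 𝔣 𝔞) (hne : red (F.EU 𝔞) ≠ 0) :
    ∀ y ∈ F.HS, zS ≠ π • y :=
  not_exists_eq_smul_of_weakShape p 𝔣 h.weak hz red hred h𝔞 hne

/-- **Under the weak form the zeta line contains every elliptic-unit class**: `EU_𝔞 ∈ R·𝐳_{γ′}` (the form in which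
a consumer compares `Λ_O·𝐳_{γ′}` with the part of elliptic units, e.g. for Prop. 15.17-type length arguments).
[cite: Kato2004Asterisque, §15.16 (15.16.1) and Prop. 15.17 (p. 265)] -/
theorem EU_mem_span_zeta_of_weakShape {F : Frame1516 (K := K) R A} (h : Kato15161WeakShape p 𝔣 F)
    {𝔞 : Ideal (𝓞 K)} (h𝔞 : IsTwist p 𝔣 𝔞) : F.EU 𝔞 ∈ R ∙ F.zeta := by
  obtain ⟨C, hC⟩ := h 𝔞 h𝔞
  rw [hC]
  exact Submodule.smul_mem _ C (Submodule.mem_span_singleton_self _)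

end Shape

end Literature.NumberTheory.EllipticCurves.Kato2004.CMTwisted

end
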